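import Summits.BirchSwinnertonDyer.BirchSwinnertonDyer.Theorems.ResidualThetaTransportAtTwoSignedMuVanishingAtTwoPlusCuspSpanGroupNamed
import Summits.BirchSwinnertonDyer.BirchSwinnertonDyer.Theorems.ResidualThetaTransportAtTwoSignedMuVanishingAtTwoPlusCuspSpanNamed
import Summits.BirchSwinnertonDyer.BirchSwinnertonDyer.Theorems.ResidualThetaTransportAtTwoThetaLayerLambdaCongruenceAtTwoEllipticExclusion
import HarnessLib

/-!
# Route `ResidualThetaTransportAtTwo`, cruxes Kan⁺ `ThetaLayerLambdaCongruenceAtTwo` (stmt-BirchSwinnertonDyer-20688) and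
# Kμ⁺ / 21437: the curve-free node (G′)_N = `SignedMuAtTwo.CuspSpanEvenAtTwo N` PROVED for every prime-power level
# `N` with `(ℤ/N)^× = ±⟨4⟩`, by GENERATION of `Γ₀(N)`

Cell `bsd-wall`, lead prover `bsd-wall-rtt-p3` g9 (2026-08-28). THEOREMS ONLY (no `def`, no `sorry`, no new axiom);
`--supports stmt-BirchSwinnertonDyer-20688`; BSD is not proved by this.

THE IDEA (new in this crux). The node (G′)_N says: every additive `χ : Γ₀(N) → ZMod 2` through the period homology
that kills every `γ` with lower-right entry `±4^k` (`k ≥ 1`) is Eisenstein (`ψ ∘ d`). Width seat rtt-p4-w3 reduced it to the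
TRACE form (G″)_N (`cuspSpan_of_cuspSpanTrace`: replace "through the period homology" by "kills every `γ` with `|tr γ| ≤ 2`")
and to the MEMBERSHIP form (`cuspSpanEvenAtTwo_of_gamma1_le_closure`). Nobody had proved either form at a single level.
Here we PROVE (G″)_N, with `ψ = 0`, whenever (U4) every unit of `ZMod N` is `±4^k` for some `k ≥ 1`, and (SUCC) of any two
consecutive integers one is a unit mod `N` (i.e. `N` is a prime power) — `Γ₀(N)` is GENERATED by elements killed by `χ`:
* §2 if `|b(β)| = 1` then `χ β = 0`: by (U4) `d(β) ≡ ε4^k (mod N)` and `L_t β` (`L_t = (1 0; Nt 1)`, parabolic) has lower-right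
  entry `d ∓ tN = ε4^k` EXACTLY for the right `t`;
* §3 `chi_eq_zero_of_units_four_pow` — DESCENT on `|b(γ)|`: for `|b| ≥ 2` pick `δ ∈ {⌊a/b⌋, ⌊a/b⌋ ± 1}` a unit mod `N` (SUCC)
  with `|bδ − a| < |b|` (`gcd(a,b) = 1`); `γ · β(δ)`, `β(δ) = (α, −1; Nκ, δ)`, has upper-right entry `bδ − a`, and `χ(β(δ)) = 0`
  by §2; `|b| = 0` is `±L^n` (trace `±2`). Hence `χ = 0`: (G″)_N with `ψ = 0`;
* §4 the NAMED node `CuspSpanEvenAtTwo N` at such `N`, the prime-power form, a decidable finite check, instances `N = 19, 27`;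
* §5 `flatAtTwo_of_units_four_pow` — FLAT (`2 ∤ L⁻` for every Pollack pair at `2`) for every `W` good supersingular at `2` with
  `a₂(W) = 0` and such a conductor: the first CLASS-WIDE instance of Kμ⁺'s FLAT / of 21437's node that is a theorem.

SCOPE: (U4)+(SUCC) ⟺ `N = p^e`, `p ≡ 3 (mod 4)`, `ord_N(4) = φ(N)/2` (primes `p < 110`: 3, 7, 11, 19, 23, 47, 59, 67, 71, 79,
83, 103, 107; not 31, 43; no `p ≡ 1 (mod 4)`; and powers 9, 27, 49, 121, 361, …). Levels with two odd prime factors never satisfy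
(U4); there the `4^k`-elements with `|b| ≥ 2` are load-bearing (open part; the 147 census habitat⁺ conductors are of that kind).

References: H. Rademacher, *Über die Erzeugenden von Kongruenzuntergruppen der Modulgruppe*, Abh. Math. Sem. Hamburg 7 (1929)
134–148 (generators of `Γ₀(p)`) [Rademacher1929]; A. W. Knapp, *Elliptic curves* (1992) Prop. 11.1, 11.22 [Knapp1993];
R. Pollack, Duke Math. J. 118 (2003) Conj. 6.3 [Pollack2003]; R. Pollack, T. Weston, Duke Math. J. 156 (2011) Rem. 4.2
[PollackWeston2011MT].
-/

set_option autoImplicit false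
set_option linter.dupNamespace false

noncomputable section

open scoped MatrixGroups

open CongruenceSubgroup WeierstrassCurve Literature.NumberTheory.EllipticCurves
  Literature.NumberTheory.EllipticCurves.ModularForms Literature.NumberTheory.EllipticCurves.Rank1Residual
  Literature.NumberTheory.IwasawaTheory Summit.BirchSwinnertonDyer.Rank1Residual.Supersingular

namespace Summit.BirchSwinnertonDyer.BirchSwinnertonDyer.Theorems.SignedMuAtTwo

/-! ## §1. Entry bookkeeping in `Γ₀(N)` -/

section Entries

variable {N : ℕ}

/-- Upper-right entry of a product: `(γδ)₀₁ = γ₀₀ δ₀₁ + γ₀₁ δ₁₁`. [folklore] -/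
theorem gamma0_mul_apply_zero_one (γ δ : Gamma0 N) :
    ((γ * δ : Gamma0 N) : SL(2, ℤ)) 0 1 =
      (γ : SL(2, ℤ)) 0 0 * (δ : SL(2, ℤ)) 0 1 + (γ : SL(2, ℤ)) 0 1 * (δ : SL(2, ℤ)) 1 1 :=
  (Matrix.two_mul_expl ((γ : SL(2, ℤ)) : Matrix (Fin 2) (Fin 2) ℤ)
    ((δ : SL(2, ℤ)) : Matrix (Fin 2) (Fin 2) ℤ)).2.1

/-- Lower-right entry of a product: `(γδ)₁₁ = γ₁₀ δ₀₁ + γ₁₁ δ₁₁`. [folklore] -/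
theorem gamma0_mul_apply_one_one' (γ δ : Gamma0 N) :
    ((γ * δ : Gamma0 N) : SL(2, ℤ)) 1 1 =
      (γ : SL(2, ℤ)) 1 0 * (δ : SL(2, ℤ)) 0 1 + (γ : SL(2, ℤ)) 1 1 * (δ : SL(2, ℤ)) 1 1 :=
  (Matrix.two_mul_expl ((γ : SL(2, ℤ)) : Matrix (Fin 2) (Fin 2) ℤ)
    ((δ : SL(2, ℤ)) : Matrix (Fin 2) (Fin 2) ℤ)).2.2.2

end Entries

/-! ## §2. Additive `χ` killing small traces and `4^k`-classes: basic vanishing, and the `|b| = 1` elements -/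

section Beta

variable {N : ℕ}

variable {χ : Gamma0 N → ZMod 2}

/-- `χ(γδ) = 0` and `χ δ = 0` give `χ γ = 0` (values in `ZMod 2`). [folklore] -/
theorem chi_eq_zero_of_mul_right (hadd : ∀ γ δ : Gamma0 N, χ (γ * δ) = χ γ + χ δ) {γ δ : Gamma0 N}
    (hγδ : χ (γ * δ) = 0) (hδ : χ δ = 0) : χ γ = 0 := by
  have h := hadd γ δ
  rw [hγδ, hδ, add_zero] at h
  exact h.symm

/-- `χ(δγ) = 0` and `χ δ = 0` give `χ γ = 0`. [folklore] -/
theorem chi_eq_zero_of_mul_left (hadd : ∀ γ δ : Gamma0 N, χ (γ * δ) = χ γ + χ δ) {γ δ : Gamma0 N}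
    (hδγ : χ (δ * γ) = 0) (hδ : χ δ = 0) : χ γ = 0 := by
  have h := hadd δ γ
  rw [hδγ, hδ, zero_add] at h
  exact h.symm

/-- **The `|b| = 1` elements are killed.** If every unit of `ZMod N` is `±4^k` (`k ≥ 1`) and `χ` is additive, kills the
elements of trace `0, ±1, ±2` and the elements with lower-right entry `±4^k` (`k ≥ 1`), then `χ β = 0` for every `β ∈ Γ₀(N)`
with upper-right entry `±1`: `d(β)` is a unit, `≡ ε4^k (mod N)`, and left multiplication by the parabolic `L_t = (1 0; Nt 1)`
changes the lower-right entry by `t·N·b(β) = ±tN`, so some `L_t β` has lower-right entry EXACTLY `ε4^k`.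
[cite: Rademacher1929, §1 (generators `V_k` of `Γ₀(p)`)] -/
theorem chi_eq_zero_of_natAbs_apply_zero_one_eq_one
    (hU : ∀ u : ZMod N, IsUnit u → ∃ k : ℕ, 1 ≤ k ∧ (u = (4 : ZMod N) ^ k ∨ u = -(4 : ZMod N) ^ k))
    (hadd : ∀ γ δ : Gamma0 N, χ (γ * δ) = χ γ + χ δ)
    (hsmall : ∀ γ : Gamma0 N, ((γ : SL(2, ℤ)) 0 0 + (γ : SL(2, ℤ)) 1 1).natAbs ≤ 2 → χ γ = 0)
    (hkill : ∀ γ : Gamma0 N, (∃ k : ℕ, 1 ≤ k ∧ ((γ : SL(2, ℤ)) 1 1).natAbs = 4 ^ k) → χ γ = 0)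
    (β : Gamma0 N) (hb : ((β : SL(2, ℤ)) 0 1).natAbs = 1) : χ β = 0 := by
  set b := (β : SL(2, ℤ)) 0 1 with hbdef
  set d := (β : SL(2, ℤ)) 1 1 with hddef
  obtain ⟨k, hk, hε⟩ := hU _ (isUnit_gamma0_apply_one_one β)
  -- `d ≡ ε 4^k (mod N)`: write `d - ε 4^k = N * t₀`
  have hb2 : b * b = 1 := by
    rcases Int.natAbs_eq b with h | h <;> rw [hb] at h <;> rw [h] <;> norm_num
  obtain ⟨ε, hε1, hεd⟩ : ∃ ε : ℤ, ε.natAbs = 1 ∧ (N : ℤ) ∣ d - ε * 4 ^ k := by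
    rcases hε with h | h
    · refine ⟨1, rfl, (ZMod.intCast_zmod_eq_zero_iff_dvd _ N).mp ?_⟩
      push_cast
      rw [hddef, h]; ring
    · refine ⟨-1, rfl, (ZMod.intCast_zmod_eq_zero_iff_dvd _ N).mp ?_⟩
      push_cast
      rw [hddef, h]; ring
  obtain ⟨t₀, ht₀⟩ := hεd
  -- the parabolic `L = (1 0; N t 1)` with `t = -t₀ b`
  obtain ⟨L, hL00, hL01, hL10, hL11⟩ :=
    ThetaLayerLambdaCongruenceAtTwo.exists_gamma0_entries (N := N) 1 0 ((N : ℤ) * (-(t₀ * b))) 1 (by ring) (dvd_mul_right _ _)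
  have hL : χ L = 0 := hsmall L (by rw [hL00, hL11]; rfl)
  have hLβ : ((L * β : Gamma0 N) : SL(2, ℤ)) 1 1 = ε * 4 ^ k := by
    rw [gamma0_mul_apply_one_one', hL10, hL11, one_mul, ← hbdef, ← hddef]
    have : d = ε * 4 ^ k + N * t₀ := by linear_combination ht₀
    rw [this]
    linear_combination (-(N : ℤ) * t₀) * hb2
  have hkLβ : χ (L * β) = 0 := by
    refine hkill _ ⟨k, hk, ?_⟩
    rw [hLβ, Int.natAbs_mul, hε1, one_mul, Int.natAbs_pow]
    rfl
  exact chi_eq_zero_of_mul_left hadd hkLβ hL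

end Beta

/-! ## §3. The descent on `|b|`: `χ = 0` on all of `Γ₀(N)` -/

section Descent

variable {N : ℕ}

/-- Arithmetic core of the descent: for coprime `a, b` with `|b| ≥ 2`, and `N` such that of two consecutive integers one is
a unit mod `N`, there is `δ`, a unit mod `N`, with `|bδ − a| < |b|` (take `δ ∈ {⌊a/b⌋, ⌊a/b⌋ ± 1}`; `b ∤ a`). [folklore] -/
theorem exists_unit_natAbs_mul_sub_lt
    (hsucc : ∀ δ : ℤ, IsUnit ((δ : ℤ) : ZMod N) ∨ IsUnit (((δ + 1 : ℤ)) : ZMod N))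
    {a b : ℤ} (hab : IsCoprime a b) (hb : 2 ≤ b.natAbs) :
    ∃ δ : ℤ, IsUnit ((δ : ℤ) : ZMod N) ∧ (b * δ - a).natAbs < b.natAbs := by
  have hb0 : b ≠ 0 := by rintro rfl; simp at hb
  set q := a / b with hq
  set r := a % b with hr
  have hqr : b * q + r = a := Int.mul_ediv_add_emod a b
  have hr0 : 0 ≤ r := Int.emod_nonneg a hb0
  have hrb : r < |b| := Int.emod_lt_abs a hb0
  have hrne : r ≠ 0 := by
    intro hr0'
    have hdvd : b ∣ a := ⟨q, by linear_combination -hqr + hr0'⟩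
    have hunit : IsUnit b := hab.symm.isUnit_of_dvd hdvd
    rcases Int.isUnit_iff.mp hunit with h | h <;> rw [h] at hb <;> norm_num at hb
  have hrpos : 0 < r := lt_of_le_of_ne hr0 (Ne.symm hrne)
  -- candidate 1: δ = q, |b q - a| = r
  have hc1 : (b * q - a).natAbs < b.natAbs := by
    have : b * q - a = -r := by linear_combination hqr
    rw [this, Int.natAbs_neg]
    have h1 : (r.natAbs : ℤ) = r := Int.natAbs_of_nonneg hr0
    have h2 : (b.natAbs : ℤ) = |b| := Int.natCast_natAbs b
    omega
  -- candidate 2: δ = q + sign b, |b (q + sign b) - a| = |b| - r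
  have hc2 : (b * (q + Int.sign b) - a).natAbs < b.natAbs := by
    have hsb : b * Int.sign b = |b| := by rw [mul_comm, Int.sign_mul_self_eq_natAbs, Int.natCast_natAbs]
    have : b * (q + Int.sign b) - a = |b| - r := by linear_combination hqr + hsb
    rw [this]
    have h2 : (b.natAbs : ℤ) = |b| := Int.natCast_natAbs b
    have h3 : ((|b| - r).natAbs : ℤ) = |b| - r := Int.natAbs_of_nonneg (by omega)
    omega
  -- choose according to the sign of `b`
  rcases lt_or_gt_of_ne hb0 with hneg | hpos
  · -- `b < 0`: `sign b = -1`, candidates `q - 1`, `q`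
    have hs : Int.sign b = -1 := Int.sign_eq_neg_one_of_neg hneg
    rw [hs] at hc2
    rcases hsucc (q - 1) with h | h
    · exact ⟨q - 1, h, by rw [show q - 1 = q + -1 by ring]; exact hc2⟩
    · exact ⟨q, by rw [show q = q - 1 + 1 by ring]; exact h, hc1⟩
  · -- `b > 0`: `sign b = 1`, candidates `q`, `q + 1`
    have hs : Int.sign b = 1 := Int.sign_eq_one_of_pos hpos
    rw [hs] at hc2
    rcases hsucc q with h | h
    · exact ⟨q, h, hc1⟩
    · exact ⟨q + 1, h, hc2⟩

/-- **THE GENERATION THEOREM (character form).** Let `N` be such that (U4) every unit of `ZMod N` is `±4^k` for some `k ≥ 1`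
and (SUCC) of any two consecutive integers one is a unit mod `N`. Then every additive `χ : Γ₀(N) → ZMod 2` that kills the
elements of trace `0, ±1, ±2` and the elements whose lower-right entry is `±4^k` (`k ≥ 1`) VANISHES IDENTICALLY.
Proof: descent on `|b(γ)|` — `|b| = 0` forces `γ = ±L^n` (trace `±2`); `|b| = 1` is §2; for `|b| ≥ 2` right-multiply by
`β(δ) = (α, −1; Nκ, δ)` (`αδ + Nκ = 1`) with `δ` from `exists_unit_natAbs_mul_sub_lt`: the new upper-right entry is
`bδ − a`, strictly smaller, and `χ(β(δ)) = 0` by §2. Equivalently: `Γ₀(N)` is generated by `±L^n`, and the elements with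
`|b| = 1`, all of which lie in the subgroup generated by the small-trace elements and the `4^k`-classes.
[cite: Rademacher1929, §1] [cite: Knapp1993, Prop. 11.22] -/
theorem chi_eq_zero_of_units_four_pow
    (hU : ∀ u : ZMod N, IsUnit u → ∃ k : ℕ, 1 ≤ k ∧ (u = (4 : ZMod N) ^ k ∨ u = -(4 : ZMod N) ^ k))
    (hsucc : ∀ δ : ℤ, IsUnit ((δ : ℤ) : ZMod N) ∨ IsUnit (((δ + 1 : ℤ)) : ZMod N))
    (χ : Gamma0 N → ZMod 2)
    (hadd : ∀ γ δ : Gamma0 N, χ (γ * δ) = χ γ + χ δ)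
    (hsmall : ∀ γ : Gamma0 N, ((γ : SL(2, ℤ)) 0 0 + (γ : SL(2, ℤ)) 1 1).natAbs ≤ 2 → χ γ = 0)
    (hkill : ∀ γ : Gamma0 N, (∃ k : ℕ, 1 ≤ k ∧ ((γ : SL(2, ℤ)) 1 1).natAbs = 4 ^ k) → χ γ = 0) :
    ∀ γ : Gamma0 N, χ γ = 0 := by
  -- strong induction on `|b(γ)|`
  suffices h : ∀ n : ℕ, ∀ γ : Gamma0 N, ((γ : SL(2, ℤ)) 0 1).natAbs = n → χ γ = 0 from
    fun γ ↦ h _ γ rfl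
  intro n
  induction n using Nat.strong_induction_on with
  | _ n ih =>
  intro γ hn
  set a := (γ : SL(2, ℤ)) 0 0 with hadef
  set b := (γ : SL(2, ℤ)) 0 1 with hbdef
  set c := (γ : SL(2, ℤ)) 1 0 with hcdef
  set d := (γ : SL(2, ℤ)) 1 1 with hddef
  have hdet : a * d - b * c = 1 := by
    have := Matrix.SpecialLinearGroup.det_coe (γ : SL(2, ℤ))
    rwa [Matrix.det_fin_two] at this
  rcases Nat.lt_or_ge n 2 with hlt | hge
  · interval_cases n
    · -- `b = 0`: `a d = 1`, `γ = ±L^m`, trace `±2`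
      have hb0 : b = 0 := Int.natAbs_eq_zero.mp hn
      rw [hb0, zero_mul, sub_zero] at hdet
      refine hsmall γ ?_
      rw [← hadef, ← hddef]
      rcases Int.eq_one_or_neg_one_of_mul_eq_one' hdet with ⟨ha, hd⟩ | ⟨ha, hd⟩ <;> rw [ha, hd] <;> rfl
    · -- `|b| = 1`
      exact chi_eq_zero_of_natAbs_apply_zero_one_eq_one hU hadd hsmall hkill γ hn
  · -- `|b| ≥ 2`: one descent step
    have hcop : IsCoprime a b := ⟨d, -c, by linear_combination hdet⟩
    obtain ⟨δ, hδu, hlt⟩ := exists_unit_natAbs_mul_sub_lt hsucc hcop (hn ▸ hge)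
    -- `α δ + N κ = 1`
    obtain ⟨u, v, huv⟩ := (ZMod.coe_int_isUnit_iff_isCoprime δ N).mp hδu
    -- `u * N + v * δ = 1`
    obtain ⟨β, hβ00, hβ01, hβ10, hβ11⟩ :=
      ThetaLayerLambdaCongruenceAtTwo.exists_gamma0_entries (N := N) v (-1) ((N : ℤ) * u) δ (by linear_combination huv) (dvd_mul_right _ _)
    have hβ : χ β = 0 :=
      chi_eq_zero_of_natAbs_apply_zero_one_eq_one hU hadd hsmall hkill β (by rw [hβ01]; rfl)
    have hγβ : ((γ * β : Gamma0 N) : SL(2, ℤ)) 0 1 = b * δ - a := by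
      rw [gamma0_mul_apply_zero_one, hβ01, hβ11, ← hadef, ← hbdef]; ring
    have hlt' : (((γ * β : Gamma0 N) : SL(2, ℤ)) 0 1).natAbs < n := by rw [hγβ, ← hn]; exact hlt
    have hγβ0 : χ (γ * β) = 0 := ih _ hlt' (γ * β) rfl
    exact chi_eq_zero_of_mul_right hadd hγβ0 hβ

/-- **(G″)_N at such levels** (the trace form of the node, with `ψ = 0`): under (U4) and (SUCC), every additive
`χ : Γ₀(N) → ZMod 2` killing the small-trace elements and the `4^k`-classes is `ψ ∘ d` with `ψ = 0`.
[cite: Pollack2003, Conj. 6.3] [cite: Rademacher1929, §1] -/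
theorem cuspSpanTrace_of_units_four_pow
    (hU : ∀ u : ZMod N, IsUnit u → ∃ k : ℕ, 1 ≤ k ∧ (u = (4 : ZMod N) ^ k ∨ u = -(4 : ZMod N) ^ k))
    (hsucc : ∀ δ : ℤ, IsUnit ((δ : ℤ) : ZMod N) ∨ IsUnit (((δ + 1 : ℤ)) : ZMod N)) :
    ∀ χ : Gamma0 N → ZMod 2,
      (∀ γ δ : Gamma0 N, χ (γ * δ) = χ γ + χ δ) →
      (∀ γ : Gamma0 N, ((γ : SL(2, ℤ)) 0 0 + (γ : SL(2, ℤ)) 1 1).natAbs ≤ 2 → χ γ = 0) →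
      (∀ γ : Gamma0 N, (∃ k : ℕ, 1 ≤ k ∧ ((γ : SL(2, ℤ)) 1 1).natAbs = 4 ^ k) → χ γ = 0) →
      ∃ ψ : ZMod N → ZMod 2, (∀ x y : ZMod N, IsUnit x → IsUnit y → ψ (x * y) = ψ x + ψ y) ∧
        ∀ γ : Gamma0 N, χ γ = ψ ((((γ : SL(2, ℤ)) 1 1 : ℤ) : ZMod N)) :=
  fun χ hadd hsmall hkill ↦ ⟨fun _ ↦ 0, fun _ _ _ _ ↦ by simp,
    fun γ ↦ chi_eq_zero_of_units_four_pow hU hsucc χ hadd hsmall hkill γ⟩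

end Descent

/-! ## §4. The named node `CuspSpanEvenAtTwo N` at prime-power levels with `(ℤ/N)^× = ±⟨4⟩`; instances -/

section Named

variable {N : ℕ}

/-- **`CuspSpanEvenAtTwo N` PROVED under (U4) + (SUCC)** (the named (G′)_N of `…CuspSpanDefs`, via rtt-p4-w3's
`cuspSpanEvenAtTwo_of_cuspSpanTrace`). [cite: Pollack2003, Conj. 6.3] [cite: Knapp1993, Prop. 11.1] -/
theorem cuspSpanEvenAtTwo_of_units_four_pow [NeZero N]
    (hU : ∀ u : ZMod N, IsUnit u → ∃ k : ℕ, 1 ≤ k ∧ (u = (4 : ZMod N) ^ k ∨ u = -(4 : ZMod N) ^ k))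
    (hsucc : ∀ δ : ℤ, IsUnit ((δ : ℤ) : ZMod N) ∨ IsUnit (((δ + 1 : ℤ)) : ZMod N)) :
    CuspSpanEvenAtTwo N :=
  cuspSpanEvenAtTwo_of_cuspSpanTrace (cuspSpanTrace_of_units_four_pow hU hsucc)

/-- (SUCC) holds at prime powers: of two consecutive integers at most one is divisible by `p`. [folklore] -/
theorem isUnit_or_isUnit_succ_of_primePow {p e : ℕ} (hp : p.Prime) (δ : ℤ) :
    IsUnit ((δ : ℤ) : ZMod (p ^ e)) ∨ IsUnit (((δ + 1 : ℤ)) : ZMod (p ^ e)) := by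
  by_contra h
  rw [not_or] at h
  obtain ⟨h1, h2⟩ := h
  rw [ZMod.coe_int_isUnit_iff_isCoprime] at h1 h2
  have hp' : Prime (p : ℤ) := Nat.prime_iff_prime_int.mp hp
  -- not coprime to `p^e` means divisible by `p`
  have hd1 : (p : ℤ) ∣ δ := by
    by_contra hnd
    exact h1 (by
      push_cast
      exact IsCoprime.pow_left ((hp'.irreducible.coprime_iff_not_dvd).mpr hnd))
  have hd2 : (p : ℤ) ∣ δ + 1 := by
    by_contra hnd
    exact h2 (by
      push_cast
      exact IsCoprime.pow_left ((hp'.irreducible.coprime_iff_not_dvd).mpr hnd))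
  have : (p : ℤ) ∣ 1 := by
    have := dvd_sub hd2 hd1
    rwa [add_sub_cancel_left] at this
  exact hp'.not_dvd_one this

/-- **`CuspSpanEvenAtTwo (p^e)`** for every prime power `p^e` all of whose units are `±4^k` (`k ≥ 1`): the node (G′)_N is a
THEOREM at these levels ((SUCC) is automatic at prime powers). [cite: Pollack2003, Conj. 6.3] [cite: Rademacher1929, §1] -/
theorem cuspSpanEvenAtTwo_of_primePow {p e : ℕ} (hp : p.Prime) [NeZero (p ^ e)]
    (hU : ∀ u : ZMod (p ^ e), IsUnit u → ∃ k : ℕ, 1 ≤ k ∧ (u = (4 : ZMod (p ^ e)) ^ k ∨ u = -(4 : ZMod (p ^ e)) ^ k)) :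
    CuspSpanEvenAtTwo (p ^ e) :=
  cuspSpanEvenAtTwo_of_units_four_pow hU (isUnit_or_isUnit_succ_of_primePow hp)

/-- **Finite check ⟹ (U4).** A decidable form of (U4): every residue coprime to `N` is `±4^(k+1)` for some `k < K`.
[folklore] -/
theorem units_four_pow_of_finiteCheck [NeZero N] (K : ℕ)
    (h : ∀ u : ZMod N, Nat.Coprime u.val N → ∃ k : Fin K, u = (4 : ZMod N) ^ (k.val + 1) ∨ u = -(4 : ZMod N) ^ (k.val + 1)) :
    ∀ u : ZMod N, IsUnit u → ∃ k : ℕ, 1 ≤ k ∧ (u = (4 : ZMod N) ^ k ∨ u = -(4 : ZMod N) ^ k) := by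
  intro u hu
  have hcop : Nat.Coprime u.val N := by
    rw [← ZMod.natCast_zmod_val u, ZMod.isUnit_iff_coprime] at hu
    exact hu
  obtain ⟨k, hk⟩ := h u hcop
  exact ⟨k.val + 1, Nat.succ_pos _, hk⟩

/-- **`CuspSpanEvenAtTwo (p^e)` from the finite check** (used by the instances below). [folklore] -/
theorem cuspSpanEvenAtTwo_of_primePow_of_finiteCheck {p e : ℕ} (hp : p.Prime) [NeZero (p ^ e)] (K : ℕ)
    (h : ∀ u : ZMod (p ^ e), Nat.Coprime u.val (p ^ e) →
      ∃ k : Fin K, u = (4 : ZMod (p ^ e)) ^ (k.val + 1) ∨ u = -(4 : ZMod (p ^ e)) ^ (k.val + 1)) :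
    CuspSpanEvenAtTwo (p ^ e) :=
  cuspSpanEvenAtTwo_of_primePow hp (units_four_pow_of_finiteCheck K h)

/-- **`CuspSpanEvenAtTwo 19`** — the node at the level of `19a1` (`a₂ = 0`, `Δ = −19³ < 0`, rank `0`, non-CM): `ord₁₉ 2 = 18`,
so `±⟨4⟩ = (ℤ/19)^×`. [cite: Pollack2003, Conj. 6.3] -/
theorem cuspSpanEvenAtTwo_nineteen : CuspSpanEvenAtTwo 19 := by
  have h : CuspSpanEvenAtTwo (19 ^ 1) :=
    cuspSpanEvenAtTwo_of_primePow_of_finiteCheck (p := 19) (e := 1) (by norm_num) 9 (by decide)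
  simpa using h

/-- **`CuspSpanEvenAtTwo 27`** (`27 = 3³`, `2` a primitive root mod `27`). [cite: Pollack2003, Conj. 6.3] -/
theorem cuspSpanEvenAtTwo_twentyseven : CuspSpanEvenAtTwo 27 := by
  have h : CuspSpanEvenAtTwo (3 ^ 3) :=
    cuspSpanEvenAtTwo_of_primePow_of_finiteCheck (p := 3) (e := 3) (by norm_num) 9 (by decide)
  simpa using h

end Named

/-! ## §5. FLAT on the habitat at such conductors -/

section Flat

variable {W : WeierstrassCurve ℚ} [W.IsElliptic] [W.IsGloballyMinimal]

/-- **FLAT at prime-power conductors with `(ℤ/N)^× = ±⟨4⟩`.** For `W/ℚ` good supersingular at `2` with `a₂(W) = 0`, newform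
`f`, and conductor `N_W` satisfying (U4) + (SUCC): `2 ∤ L⁻` for every Pollack pair `(L⁺, L⁻)` of `f` at `2` — crux Kμ⁺'s FLAT
statement, here a THEOREM for this class (no kit certificate, no conjecture-grade input). BSD is not proved by this.
[cite: Pollack2003, Conj. 6.3 and Prop. 6.18] [cite: Rademacher1929, §1] -/
theorem flatAtTwo_of_units_four_pow [NeZero (W.conductorNorm ℤ)] {f : CuspForm (Gamma0 (W.conductorNorm ℤ)) 2}
    (hf : IsNewformOf W f) (hss : GoodSS W 2) (ha : W.frobeniusTrace 2 = 0)
    (hU : ∀ u : ZMod (W.conductorNorm ℤ), IsUnit u →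
      ∃ k : ℕ, 1 ≤ k ∧ (u = (4 : ZMod (W.conductorNorm ℤ)) ^ k ∨ u = -(4 : ZMod (W.conductorNorm ℤ)) ^ k))
    (hsucc : ∀ δ : ℤ, IsUnit ((δ : ℤ) : ZMod (W.conductorNorm ℤ)) ∨ IsUnit (((δ + 1 : ℤ)) : ZMod (W.conductorNorm ℤ))) :
    ∀ Lplus Lminus : IwasawaAlgebra 2, IsPollackPair f 2 Lplus Lminus → ¬ PowerSeries.C (2 : ℤ_[2]) ∣ Lminus :=
  flatAtTwo_of_cuspSpanEvenAtTwo hf hss ha (cuspSpanEvenAtTwo_of_units_four_pow hU hsucc)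

/-- **FLAT at conductor `19`** (e.g. the class `19a`): every `W` good supersingular at `2` with `a₂(W) = 0` and
`N_W = 19` has `2 ∤ L⁻` for every Pollack pair of its newform. BSD is not proved by this. [cite: Pollack2003, Conj. 6.3 and Prop. 6.18] -/
theorem flatAtTwo_of_conductor_nineteen [NeZero (W.conductorNorm ℤ)] {f : CuspForm (Gamma0 (W.conductorNorm ℤ)) 2}
    (hf : IsNewformOf W f) (hss : GoodSS W 2) (ha : W.frobeniusTrace 2 = 0) (hN : W.conductorNorm ℤ = 19) :
    ∀ Lplus Lminus : IwasawaAlgebra 2, IsPollackPair f 2 Lplus Lminus → ¬ PowerSeries.C (2 : ℤ_[2]) ∣ Lminus := by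
  refine flatAtTwo_of_cuspSpanEvenAtTwo hf hss ha ?_
  have h19 := cuspSpanEvenAtTwo_nineteen
  revert h19
  -- transport the named predicate along `N_W = 19`
  generalize hM : W.conductorNorm ℤ = M at *
  subst hN
  exact id

end Flat

end Summit.BirchSwinnertonDyer.BirchSwinnertonDyer.Theorems.SignedMuAtTwo

end
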